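import Literature.AnabelianGeometry.AbsoluteAnabelian.AbsTopIProp23SlimProofs
import Literature.AnabelianGeometry.AbsoluteAnabelian.MLFAbsoluteGaloisGroupInfinite
import Literature.AnabelianGeometry.AbsoluteAnabelian.NFGaloisNotTFGProofs
import HarnessLib

/-!
# [AbsTopI] Prop 2.3 (ii): the input «`Δ` has infinite index in `Π`» discharged for MLF / NF bases

S. Mochizuki, *Topics in Absolute Anabelian Geometry I: Generalities* (2012) [AbsTopI], Prop 2.3
(ii), manuscript p. 19 (lit key `paper:url-11ac98ba15fc`): for `1 → Δ → Π → G → 1` of GSAFG-type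
with base-stack a hyperbolic orbicurve, `Σ ≠ ∅`, and `k` an MLF or an NF, "`Π` is slim, but not
elastic"; proof (p. 19): "the fact that `Π` is not elastic follows from the existence of the
nontrivial, topologically finitely generated [cf. Proposition 2.2], closed, normal, infinite index
subgroup `Δ ⊆ Π`."

abc-iut-L4-t4 typed the conclusion as `FundamentalExtension.ArithSlimNotElastic` (FACT-LIST F-0238)
and proved the formal step `not_isElastic_of_geom (hne) (htfg) (hinf)`; abc-iut-L4-d2's
`AbsTopIProp23SlimProofs.lean` assembled `MLFBase.arithSlimNotElastic` / `NFBase.arithSlimNotElastic`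
from `Δ` slim, `Δ ≠ 1`, `Δ` topologically finitely generated and `hinf : ¬ Δ.FiniteIndex`.  The last
input, «`Δ` has infinite index in `Π`», is NOT geometric: `Π/Δ ≅ G ≅ G_k` and `G_k` is INFINITE for
`k` an MLF (tree theorem `IsMLF.infinite_absoluteGaloisGroup`, `MLFAbsoluteGaloisGroupInfinite.lean`)
and for `k` an NF (it is not even topologically finitely generated:
`not_isTopologicallyFinitelyGenerated_absoluteGaloisGroup`, `NFGaloisNotTFGProofs.lean`).  This
proof-only file (no definitions, no new named facts) discharges it:

* `not_finiteIndex_geom_of_infinite_gal` — for every extension, `G` infinite ⇒ `[Π : Δ] = ∞`;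
* `MLFBase.isMLF`, `MLFBase.infinite_gal`, `MLFBase.not_finiteIndex_geom`;
  `NFBase.infinite_gal`, `NFBase.not_finiteIndex_geom`;
* `MLFBase.not_isElastic_arith`, `NFBase.not_isElastic_arith` — the "not elastic" half of Prop 2.3
  (ii) from `Δ ≠ 1` and Prop 2.2 (`E.GeomTFG`) only;
* `MLFBase.arithSlimNotElastic'`, `NFBase.arithSlimNotElastic'` — Prop 2.3 (ii) AS TYPED from the
  slimness of `Δ` (Prop 2.3 (i), slimness half), `Δ ≠ 1`, and Prop 2.2 only.

HONEST FRAMING: [AbsTopI] is a refereed, undisputed paper; the three remaining inputs are about `Δ`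
and are what the campaign's `π₁` construction must supply (for a hyperbolic orbicurve `Δ` is slim,
hence nontrivial, and topologically finitely generated); nothing here bears on [IUTchIII] Cor. 3.12
or asserts anything about abc.
-/

noncomputable section

open Field Topology

namespace Literature.AnabelianGeometry.AbsoluteAnabelian

open Literature.AlgebraicGeometry.Frobenioids (IsSlimGroup)

namespace FundamentalExtension

universe u

section General

variable (E : FundamentalExtension.{u})

/-- For every extension `1 → Δ → Π → G → 1`: if `G` is infinite then `Δ` has infinite index in `Π`
(`Π/Δ ≃ G`, `quotientGeomEquivGal`). [cite: MochizukiAbsTopI2012, Prop 2.3 (ii) p.19] -/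
theorem not_finiteIndex_geom_of_infinite_gal (h : Infinite E.gal) : ¬ E.geom.FiniteIndex := by
  intro hfi
  haveI : Finite (E.arith ⧸ E.geom) := Subgroup.finite_quotient_of_finiteIndex
  haveI : Finite E.gal := Finite.of_equiv _ E.quotientGeomEquivGal.toEquiv
  exact not_finite E.gal

/-- A finite topological group is topologically finitely generated (all of its elements generate).
[cite: MochizukiAbsTopI2012, §0 p.8] -/
theorem isTopologicallyFinitelyGenerated_of_finite {G : Type u} [Group G] [TopologicalSpace G]
    [IsTopologicalGroup G] [Finite G] : IsTopologicallyFinitelyGenerated G := by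
  classical
  haveI := Fintype.ofFinite G
  refine ⟨⟨Finset.univ, ?_⟩⟩
  rw [Finset.coe_univ, Subgroup.closure_univ]
  exact top_le_iff.mp (Subgroup.le_topologicalClosure ⊤)

end General

variable {E : FundamentalExtension.{0}}

/-! ### MLF base -/

/-- The base field of MLF base data is an MLF in the sense of [AbsTopI] §0 (`IsMLF`).
[cite: MochizukiAbsTopI2012, §0 p.7] -/
theorem MLFBase.isMLF (B : E.MLFBase) : IsMLF B.K :=
  letI := B.instPrime; letI := B.instField; letI := B.instAlgebra; letI := B.instFinite
  ⟨⟨B.p, B.instPrime, algebraMap ℚ_[B.p] B.K, by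
    convert B.instFinite using 1
    exact congrArg _ (Algebra.algebra_ext _ _ fun _ => rfl)⟩⟩

/-- For an extension with MLF base data `G ≅ G_k`, `G` is infinite
(`IsMLF.infinite_absoluteGaloisGroup` transported along `galIso`).
[cite: MochizukiAbsTopI2012, Prop 2.3 (ii) p.19] -/
theorem MLFBase.infinite_gal (B : E.MLFBase) : Infinite E.gal :=
  letI := B.instField
  haveI := B.isMLF.infinite_absoluteGaloisGroup
  Infinite.of_injective (fun x => B.galIso.symm x) B.galIso.symm.injective

/-- For an extension with MLF base data, `Δ` has infinite index in `Π` — the input "infinite index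
subgroup `Δ ⊆ Π`" of the proof of Prop 2.3 (ii), DISCHARGED.
[cite: MochizukiAbsTopI2012, Prop 2.3 (ii) p.19] -/
theorem MLFBase.not_finiteIndex_geom (B : E.MLFBase) : ¬ E.geom.FiniteIndex :=
  E.not_finiteIndex_geom_of_infinite_gal B.infinite_gal

/-- **[AbsTopI] Prop 2.3 (ii), "not elastic" half**, for ANY extension with MLF base data, from
`Δ ≠ 1` and Prop 2.2 (`E.GeomTFG`) only. [cite: MochizukiAbsTopI2012, Prop 2.3 (ii) p.19] -/
theorem MLFBase.not_isElastic_arith (B : E.MLFBase) (hne : E.geom ≠ ⊥) (htfg : E.GeomTFG) :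
    ¬ IsElastic E.arith :=
  E.not_isElastic_of_geom hne htfg B.not_finiteIndex_geom

/-- **[AbsTopI] Prop 2.3 (ii) AS TYPED** ("`Π` is slim, but not elastic", `E.ArithSlimNotElastic`)
for ANY extension with MLF base data, REDUCED to: `Δ` slim (Prop 2.3 (i), slimness half), `Δ ≠ 1`,
and `Δ` topologically finitely generated (Prop 2.2) — the infinite-index input of
`MLFBase.arithSlimNotElastic` discharged. [cite: MochizukiAbsTopI2012, Prop 2.3 (ii) p.19] -/
theorem MLFBase.arithSlimNotElastic' (B : E.MLFBase) (hΔ : IsSlimGroup E.geom) (hne : E.geom ≠ ⊥)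
    (htfg : E.GeomTFG) : E.ArithSlimNotElastic :=
  B.arithSlimNotElastic hΔ hne htfg B.not_finiteIndex_geom

/-! ### NF base -/

/-- For an extension with NF base data `G ≅ G_F`, `G` is infinite (indeed not topologically
finitely generated: `not_isTopologicallyFinitelyGenerated_absoluteGaloisGroup`).
[cite: MochizukiAbsTopI2012, Prop 2.3 (ii) p.19] -/
theorem NFBase.infinite_gal (B : E.NFBase) : Infinite E.gal := by
  letI := B.instField; letI := B.instNumberField
  by_contra h
  rw [not_infinite_iff_finite] at h
  haveI : Finite (absoluteGaloisGroup B.F) := Finite.of_equiv _ B.galIso.toEquiv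
  exact not_isTopologicallyFinitelyGenerated_absoluteGaloisGroup B.F
    isTopologicallyFinitelyGenerated_of_finite

/-- For an extension with NF base data, `Δ` has infinite index in `Π` — DISCHARGED.
[cite: MochizukiAbsTopI2012, Prop 2.3 (ii) p.19] -/
theorem NFBase.not_finiteIndex_geom (B : E.NFBase) : ¬ E.geom.FiniteIndex :=
  E.not_finiteIndex_geom_of_infinite_gal B.infinite_gal

/-- **[AbsTopI] Prop 2.3 (ii), "not elastic" half**, for ANY extension with NF base data, from
`Δ ≠ 1` and Prop 2.2 only. [cite: MochizukiAbsTopI2012, Prop 2.3 (ii) p.19] -/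
theorem NFBase.not_isElastic_arith (B : E.NFBase) (hne : E.geom ≠ ⊥) (htfg : E.GeomTFG) :
    ¬ IsElastic E.arith :=
  E.not_isElastic_of_geom hne htfg B.not_finiteIndex_geom

/-- **[AbsTopI] Prop 2.3 (ii) AS TYPED** for ANY extension with NF base data, REDUCED to: `Δ` slim,
`Δ ≠ 1`, `Δ` topologically finitely generated — the infinite-index input of
`NFBase.arithSlimNotElastic` discharged. [cite: MochizukiAbsTopI2012, Prop 2.3 (ii) p.19] -/
theorem NFBase.arithSlimNotElastic' (B : E.NFBase) (hΔ : IsSlimGroup E.geom) (hne : E.geom ≠ ⊥)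
    (htfg : E.GeomTFG) : E.ArithSlimNotElastic :=
  B.arithSlimNotElastic hΔ hne htfg B.not_finiteIndex_geom

end FundamentalExtension

end Literature.AnabelianGeometry.AbsoluteAnabelian

end
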